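import Literature.Geometry.Lorentzian.KerrSchild
import Literature.Geometry.Lorentzian.BoundedGeometry
import HarnessLib

/-!
# `MultiplierOfTimelike`: the `T`-conditional multiplier form for a timelike conditioning vector
(crux `GapExhaustion`, stmt-FinalStateConjecture-10808, line photon-shell-pseudoconvexity;
registered stub `stub_multiplierOfTimelike`, far chain F2a of the conditional Killing sweep,
lead c12 wave 3)

Ionescu–Klainerman's quantitative `T`-null-convexity condition (Surveys in Differential Geometry
**20** (2015), Lemma 2.17; Invent. Math. **175** (2009), Definition 3.1 (po3)) at a point asks for
a multiplier `μ` with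

  `ε₁² |Y|² ≤ μ g(Y, Y) − Hess h(Y, Y) + ε₁⁻² (|g(T, Y)|² + |Y(h)|²)`   for all `Y`.

Where the conditioning vector `T` is TIMELIKE and the metric is close to Minkowski this holds for
ANY bounded Hessian — the only null vector `g`-orthogonal to a timelike vector is `0` — and the
present file is the quantitative algebra behind this remark, with explicit constants: if
`‖S − η‖ ≤ θ`, `‖v − ∂₀‖ ≤ θ`, `‖H‖ ≤ C` with `θ = 1/(20(C+2))`, then `μ = C + 2` and
`ε₁ = 1/(4(C+2))` work (the `|Y(h)|²` term is simply dropped). It is used by the FAR part of the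
conditional sweep, where the stationary field `∂₀` of the near-Kerr chart is uniformly timelike.

Proof: with `w₀ = w 0`, `η(w, w) = ‖w‖² − 2 w₀²`, so `S(w, w) ≥ (1 − θ)‖w‖² − 2 w₀²`;
`S(v, w) = η(∂₀, w) + η(v − ∂₀, w) + (S − η)(v, w) = −w₀ + e` with `|e| ≤ θ(2 + θ)‖w‖`
(`|η(u, w)| ≤ ‖u‖‖w‖`, `Minkowski.abs_bilin_le`), whence `S(v, w)² ≥ w₀²/2 − e²`;
`|H(w, w)| ≤ C‖w‖²`; and with `μ = C + 2`, `ε₁⁻² = 16(C+2)²` the `w₀²` coefficient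
`8(C+2)² − 2(C+2)` is nonnegative while the `‖w‖²` coefficient is at least
`2 − 1/20 − (2 + θ)²/25 ≥ 1.7 ≥ ε₁²`.

## References

* A. D. Ionescu, S. Klainerman, *Rigidity results in general relativity: a review*, Surveys in
  Differential Geometry 20 (2015), Lemma 2.17. [IonescuKlainerman2015]
* A. D. Ionescu, S. Klainerman, *On the uniqueness of smooth, stationary black holes in vacuum*,
  Invent. Math. 175 (2009), Definition 3.1.
-/

noncomputable section

-- instance search through the nested operator types `E4 →L[ℝ] E4 →L[ℝ] ℝ`
set_option maxSynthPendingDepth 3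

-- D-0017: single-problem summit, `Summit.<S>.<S>.…` by design (cf. lakefile `weak.linter.dupNamespace`).
set_option linter.dupNamespace false

namespace Summit.FinalStateConjecture.FinalStateConjecture.Theorems

open Literature.Geometry.Lorentzian

/-- `η(w, w) = ‖w‖² − 2 (w⁰)²` on `E4 = ℝ⁴` with the Euclidean norm (O'Neill 1983, Ch. 3,
p. 55). [folklore] -/
private theorem multTimelike_bilin_self (w : E4) :
    Minkowski.bilin w w = ‖w‖ ^ 2 - 2 * (w 0) ^ 2 := by
  simp only [Minkowski.bilin_apply, EuclideanSpace.real_norm_sq_eq, Fin.sum_univ_succ,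
    Fin.sum_univ_zero]
  ring

/-- `‖∂₀‖ = 1`. [folklore] -/
private theorem multTimelike_norm_basisVector_zero : ‖E4.basisVector 0‖ = 1 := by
  simp [E4.basisVector]

/-- `|B(u, w)| ≤ ‖B‖ ‖u‖ ‖w‖` for a continuous bilinear form on `E4`. [folklore] -/
private theorem multTimelike_abs_apply_le (B : E4 →L[ℝ] E4 →L[ℝ] ℝ) (u w : E4) :
    |B u w| ≤ ‖B‖ * ‖u‖ * ‖w‖ := by
  rw [← Real.norm_eq_abs]
  exact B.le_opNorm₂ u w

/-- **The `T`-conditional multiplier form for a timelike conditioning vector near Minkowski**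
(registered stub `stub_multiplierOfTimelike`, far chain F2a of line photon-shell-pseudoconvexity,
crux `GapExhaustion`): the multiplier inequality of Ionescu–Klainerman, Surveys Diff. Geom. 20
(2015), Lemma 2.17 (Invent. Math. 175 (2009), Definition 3.1 (po3)),
`ε₁²‖w‖² ≤ μ S(w,w) − H(w,w) + ε₁⁻² (S(v,w)² + D(w)²)` for all `w`, holds for EVERY symmetric
bilinear form `S` with `‖S − η‖ ≤ 1/(20(C+2))`, every conditioning vector `v` with
`‖v − ∂₀‖ ≤ 1/(20(C+2))`, every `H` with `‖H‖ ≤ C` and every covector `D`, with the explicit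
constants `μ = C + 2`, `ε₁ = 1/(4(C+2))` (a timelike conditioning vector makes the `T`-null-convexity
condition vacuous: pure algebra). [cite: IonescuKlainerman2015, Lemma 2.17] -/
theorem stub_multiplierOfTimelike : ∀ (C : ℝ), 0 ≤ C → ∀ (S H : E4 →L[ℝ] E4 →L[ℝ] ℝ) (v : E4) (D : E4 →L[ℝ] ℝ), (∀ u w : E4, S u w = S w u) → ‖S - Minkowski.bilin‖ ≤ 1 / (20 * (C + 2)) → ‖v - E4.basisVector 0‖ ≤ 1 / (20 * (C + 2)) → ‖H‖ ≤ C → ∀ w : E4, (1 / (4 * (C + 2))) ^ 2 * ‖w‖ ^ 2 ≤ (C + 2) * S w w - H w w + (1 / (4 * (C + 2)))⁻¹ ^ 2 * ((S v w) ^ 2 + (D w) ^ 2) := by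
  intro C hC S H v D _hS hSη hv hH w
  -- constants: `K = C + 2 ≥ 2`, `θ = 1/(20K) ≤ 1/40`, `ε₁ = 1/(4K) ≤ 1/8`, `ε₁⁻¹ = 4K`
  obtain ⟨K, rfl⟩ : ∃ K : ℝ, C = K - 2 := ⟨C + 2, by ring⟩
  simp only [sub_add_cancel] at hSη hv ⊢
  have hK : 2 ≤ K := by linarith
  have hKpos : 0 < K := by linarith
  obtain ⟨θ, hθ_def⟩ : ∃ θ : ℝ, θ = 1 / (20 * K) := ⟨_, rfl⟩
  rw [← hθ_def] at hSη hv
  have hθpos : 0 < θ := by rw [hθ_def]; positivity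
  have hθK : θ * K = 1 / 20 := by
    rw [hθ_def]; field_simp
  have hθle : θ ≤ 1 / 40 := by
    rw [hθ_def]
    exact one_div_le_one_div_of_le (by norm_num) (by linarith)
  have hεinv : (1 / (4 * K))⁻¹ = 4 * K := by rw [one_div, inv_inv]
  have hεle : 1 / (4 * K) ≤ 1 / 8 := one_div_le_one_div_of_le (by norm_num) (by linarith)
  have hεsq : (1 / (4 * K)) ^ 2 ≤ (1 / 8) ^ 2 :=
    pow_le_pow_left₀ (by positivity) hεle 2
  rw [hεinv]
  have hn : 0 ≤ ‖w‖ := norm_nonneg w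
  -- (1) `S(w, w) ≥ (1 − θ)‖w‖² − 2 w₀²`
  have h1 : ‖w‖ ^ 2 - 2 * (w 0) ^ 2 - θ * ‖w‖ ^ 2 ≤ S w w := by
    have hle := multTimelike_abs_apply_le (S - Minkowski.bilin) w w
    have hsub : (S - Minkowski.bilin) w w = S w w - Minkowski.bilin w w := by
      simp only [sub_apply]
    rw [hsub, multTimelike_bilin_self] at hle
    have hb : ‖S - Minkowski.bilin‖ * ‖w‖ * ‖w‖ ≤ θ * ‖w‖ ^ 2 := by
      rw [sq, ← mul_assoc]
      exact mul_le_mul_of_nonneg_right (mul_le_mul_of_nonneg_right hSη hn) hn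
    have := (abs_le.1 (hle.trans hb)).1
    linarith
  -- (2) `S(v, w) = −w₀ + e`, `|e| ≤ θ(2 + θ)‖w‖`
  have h2 : |S v w + w 0| ≤ θ * (2 + θ) * ‖w‖ := by
    have hdecomp : S v w + w 0
        = Minkowski.bilin (v - E4.basisVector 0) w + (S - Minkowski.bilin) v w := by
      rw [map_sub, sub_apply, Minkowski.bilin_basisVector_zero_left, sub_apply, sub_apply]
      ring
    have hA : |Minkowski.bilin (v - E4.basisVector 0) w| ≤ θ * ‖w‖ :=
      (Minkowski.abs_bilin_le _ _).trans (mul_le_mul_of_nonneg_right hv hn)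
    have hvn : ‖v‖ ≤ 1 + θ := by
      have := norm_le_norm_add_norm_sub' v (E4.basisVector 0)
      rw [multTimelike_norm_basisVector_zero] at this
      linarith
    have hB : |(S - Minkowski.bilin) v w| ≤ θ * (1 + θ) * ‖w‖ := by
      refine (multTimelike_abs_apply_le _ _ _).trans ?_
      have h' : ‖S - Minkowski.bilin‖ * ‖v‖ ≤ θ * (1 + θ) :=
        mul_le_mul hSη hvn (norm_nonneg v) hθpos.le
      exact mul_le_mul_of_nonneg_right h' hn
    calc |S v w + w 0|
        = |Minkowski.bilin (v - E4.basisVector 0) w + (S - Minkowski.bilin) v w| := by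
          rw [hdecomp]
      _ ≤ |Minkowski.bilin (v - E4.basisVector 0) w| + |(S - Minkowski.bilin) v w| :=
          abs_add_le _ _
      _ ≤ θ * ‖w‖ + θ * (1 + θ) * ‖w‖ := add_le_add hA hB
      _ = θ * (2 + θ) * ‖w‖ := by ring
  -- hence `S(v, w)² ≥ w₀²/2 − e²`, `e² ≤ θ²(2 + θ)²‖w‖² ≤ (2.025 θ)² ‖w‖²`
  have he2 : (S v w + w 0) ^ 2 ≤ (θ * (2 + θ) * ‖w‖) ^ 2 :=
    sq_le_sq' (abs_le.1 h2).1 (abs_le.1 h2).2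
  have hp : (w 0) ^ 2 / 2 - (θ * (2 + θ) * ‖w‖) ^ 2 ≤ (S v w) ^ 2 := by
    nlinarith [he2, sq_nonneg (S v w + w 0 / 2)]
  have hT : (θ * (2 + θ) * ‖w‖) ^ 2 ≤ (81 / 40) ^ 2 * (θ ^ 2 * ‖w‖ ^ 2) := by
    have h2θ : θ * (2 + θ) * ‖w‖ ≤ (81 / 40) * (θ * ‖w‖) := by
      have : θ * (2 + θ) * ‖w‖ = (2 + θ) * (θ * ‖w‖) := by ring
      rw [this]
      exact mul_le_mul_of_nonneg_right (by linarith) (by positivity)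
    have h0 : 0 ≤ θ * (2 + θ) * ‖w‖ := by positivity
    calc (θ * (2 + θ) * ‖w‖) ^ 2 ≤ ((81 / 40) * (θ * ‖w‖)) ^ 2 := pow_le_pow_left₀ h0 h2θ 2
      _ = (81 / 40) ^ 2 * (θ ^ 2 * ‖w‖ ^ 2) := by ring
  -- (3) `H(w, w) ≤ C‖w‖²` (`C = K − 2`)
  have h3 : H w w ≤ (K - 2) * ‖w‖ ^ 2 := by
    have hle := multTimelike_abs_apply_le H w w
    have hb : ‖H‖ * ‖w‖ * ‖w‖ ≤ (K - 2) * ‖w‖ ^ 2 := by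
      rw [sq, ← mul_assoc]
      exact mul_le_mul_of_nonneg_right (mul_le_mul_of_nonneg_right hH hn) hn
    exact (abs_le.1 (hle.trans hb)).2
  -- (4) assembly: products with the nonnegative constants, then linear arithmetic
  have hKs : K * (‖w‖ ^ 2 - 2 * (w 0) ^ 2 - θ * ‖w‖ ^ 2) ≤ K * S w w :=
    mul_le_mul_of_nonneg_left h1 hKpos.le
  have hKp : 16 * K ^ 2 * ((w 0) ^ 2 / 2 - (θ * (2 + θ) * ‖w‖) ^ 2) ≤ 16 * K ^ 2 * (S v w) ^ 2 :=
    mul_le_mul_of_nonneg_left hp (by positivity)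
  have hKT : 16 * K ^ 2 * (θ * (2 + θ) * ‖w‖) ^ 2 ≤ (81 / 40) ^ 2 / 25 * ‖w‖ ^ 2 := by
    have h16 : 16 * K ^ 2 * θ ^ 2 = 1 / 25 := by nlinarith [hθK]
    calc 16 * K ^ 2 * (θ * (2 + θ) * ‖w‖) ^ 2
        ≤ 16 * K ^ 2 * ((81 / 40) ^ 2 * (θ ^ 2 * ‖w‖ ^ 2)) :=
          mul_le_mul_of_nonneg_left hT (by positivity)
      _ = (81 / 40) ^ 2 / 25 * ‖w‖ ^ 2 * (25 * (16 * K ^ 2 * θ ^ 2)) := by ring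
      _ = (81 / 40) ^ 2 / 25 * ‖w‖ ^ 2 := by rw [h16]; ring
  have hθn : K * (θ * ‖w‖ ^ 2) = ‖w‖ ^ 2 / 20 := by
    calc K * (θ * ‖w‖ ^ 2) = θ * K * ‖w‖ ^ 2 := by ring
      _ = ‖w‖ ^ 2 / 20 := by rw [hθK]; ring
  have hw0 : 0 ≤ (8 * K ^ 2 - 2 * K) * (w 0) ^ 2 :=
    mul_nonneg (by nlinarith) (sq_nonneg _)
  have hd : 0 ≤ (4 * K) ^ 2 * (D w) ^ 2 := by positivity
  have hεn : (1 / (4 * K)) ^ 2 * ‖w‖ ^ 2 ≤ (1 / 8) ^ 2 * ‖w‖ ^ 2 :=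
    mul_le_mul_of_nonneg_right hεsq (sq_nonneg _)
  have hn2 : 0 ≤ ‖w‖ ^ 2 := sq_nonneg _
  linarith [hKs, hKp, hKT, hθn, hw0, hd, hεn, hn2, h3]

end Summit.FinalStateConjecture.FinalStateConjecture.Theorems

end
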